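import Summits.BirchSwinnertonDyer.BirchSwinnertonDyer.Theorems.ByReductionTypeAtTwoRankOneSigmaHeightResidueCertificate
import HarnessLib

/-!
# Route `ByReductionTypeAtTwo`, crux `RankOneAtTwoBigImageOddLocal` (item stmt-BirchSwinnertonDyer-23715), line AN62, σ₀-LEMMA BLOCK
# (cell `bsd-f1-sign2`, planner seat `-an` g50; `--supports 23715`, helper):
# **THE LOG-FREE LEVEL-ONE LAW `⟨Q,Q⟩_D ≡ num x(Q) − 1 − 8a₄ (mod 32)` AND THE VALUATION LAW `‖⟨Q,Q⟩_D‖₂ = ‖num x(Q) − 1 − 8a₄‖₂`**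

HONEST FRAMING (D-0036/D-0054): THEOREMS ONLY (no definition, no named fact, no `sorry`, no instance).  Binders of the unconditional
level-one law (`V/ℚ` `ℤ`-integral, `a₁ = 0`, `D` a σ-form height datum at `2`); `Q = (x, y)` with `‖x‖₂ = 4` and non-singular reduction
everywhere; `a := num x`, `n := a − 1 − 8a₄ ∈ ℤ`.  The level-one law `⟨Q,Q⟩ = log₂ a − 8a₄ + O(2⁵)` and the second-order logarithm
`log₂ a = (a − 1) + O(2‖a − 1‖₂²)` (tree `SteinWuthrich2013.norm_padicLog_one_add_sub_le`, valid at `p = 2`; `‖a − 1‖₂ ≤ ¼` at level one) give: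
`‖⟨Q,Q⟩_D − n‖₂ ≤ max(1/32, 2‖a − 1‖₂²) ≤ ⅛` (`norm_pairing_sub_int_le`), `‖⟨Q,Q⟩_D − n‖₂ ≤ 1/32` when `8 ∣ a − 1` (i.e. `a₂` even:
`norm_pairing_sub_int_le_of_dvd` — THE PAIRING IS CONGRUENT TO THE INTEGER `num x − 1 − 8a₄` MODULO `32`), and the VALUATION LAW
`32 ∤ n ⟹ ‖⟨Q,Q⟩_D‖₂ = ‖n‖₂` (`norm_pairing_eq_norm_of_not_dvd`; `v₂⟨Q,Q⟩ = v₂(n) ∈ {2,3,4}`).  Nothing here is a statement about `BSDp`;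
item 23715 stays OPEN; BSD is proved for no curve.
References: [cite: Gouvea1993PadicNumbers, §5.7 Prop. 5.7.8] [cite: SilvermanAEC2009, VII.2.2] [cite: MazurSteinTate2006, §1].
-/

set_option autoImplicit false

noncomputable section

open scoped Classical

open WeierstrassCurve PowerSeries Literature Literature.NumberTheory.EllipticCurves

namespace Summit.BirchSwinnertonDyer.BirchSwinnertonDyer.Theorems

namespace NaiveSigmaLogAtTwo

/-- `‖(log₂ a − 8a₄) − (a − 1 − 8a₄)‖₂ ≤ 2‖a − 1‖₂²` and `‖a − 1‖₂ ≤ ¼` at level one (`a = num x`, `a₁ = 0`).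
[cite: Gouvea1993PadicNumbers, §5.7 Prop. 5.7.8] -/
theorem norm_padicLog_num_sub_sub_int_le (V : WeierstrassCurve ℚ) [V.IsIntegral ℤ] {x y : ℚ} (h : V.toAffine.Nonsingular x y)
    (ha1 : V.a₁ = 0) (hx : ‖(x : ℚ_[2])‖ = 4) {A₄ : ℤ} (hA4 : V.a₄ = A₄) :
    ‖(padicLog 2 (x.num : ℚ_[2]) - 8 * (V.a₄ : ℚ_[2])) - ((x.num - 1 - 8 * A₄ : ℤ) : ℚ_[2])‖
        ≤ 2 * ‖(x.num : ℚ_[2]) - 1‖ ^ 2 ∧ ‖(x.num : ℚ_[2]) - 1‖ ≤ 4⁻¹ := by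
  have ht4 : ‖(x.num : ℚ_[2]) - 1‖ ≤ 4⁻¹ := norm_cast_num_sub_one_le_quarter V h ha1 hx
  refine ⟨?_, ht4⟩
  have hA4c : (V.a₄ : ℚ_[2]) = (A₄ : ℚ_[2]) := by rw [hA4]; push_cast; rfl
  have e : (padicLog 2 (x.num : ℚ_[2]) - 8 * (V.a₄ : ℚ_[2])) - ((x.num - 1 - 8 * A₄ : ℤ) : ℚ_[2])
      = padicLog 2 (1 + ((x.num : ℚ_[2]) - 1)) - ((x.num : ℚ_[2]) - 1) := by
    rw [hA4c, show (1 : ℚ_[2]) + ((x.num : ℚ_[2]) - 1) = (x.num : ℚ_[2]) by ring]; push_cast; ring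
  rw [e]
  exact SteinWuthrich2013.norm_padicLog_one_add_sub_le (p := 2) (ht4.trans (by norm_num))

/-- **`‖⟨Q,Q⟩_D − (num x − 1 − 8a₄)‖₂ ≤ max(1/32, 2‖num x − 1‖₂²)`** (`≤ ⅛`) at level one. [cite: MazurSteinTate2006, §1] -/
theorem norm_pairing_sub_int_le (V : WeierstrassCurve ℚ) [V.IsIntegral ℤ] (ha1 : V.a₁ = 0)
    (Sq : ℚ_[2]⟦X⟧) (h0 : constantCoeff Sq = 0) (h1 : coeff 1 Sq = 0) (h2 : coeff 2 Sq = 1) (h3 : coeff 3 Sq = 0)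
    (hODE : (V.baseChange ℚ_[2]).SatisfiesSigmaSqODE Sq 0) (D : PAdicHeightData V 2)
    (hD : ∀ {x y : ℚ} (h : V.toAffine.Nonsingular x y), V.SatisfiesLocalConditions 2 (.some x y h) →
      D.pairing (.some x y h) (.some x y h) = padicLog 2 ((x.den : ℚ) : ℚ_[2]) - padicLog 2 (padicEval Sq (-(x : ℚ_[2]) / y)))
    {x y : ℚ} (h : V.toAffine.Nonsingular x y) (hx : ‖(x : ℚ_[2])‖ = 4)
    (hns : ∀ ℓ : ℕ, ℓ.Prime → V.HasNonsingularReductionAt ℓ x y) {A₄ : ℤ} (hA4 : V.a₄ = A₄) :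
    ‖D.pairing (.some x y h) (.some x y h) - ((x.num - 1 - 8 * A₄ : ℤ) : ℚ_[2])‖
      ≤ max 32⁻¹ (2 * ‖(x.num : ℚ_[2]) - 1‖ ^ 2) := by
  obtain ⟨hlog, -⟩ := norm_padicLog_num_sub_sub_int_le V h ha1 hx hA4
  have hB := norm_pairing_sub_padicLog_num_add_le_of_norm_eq_four V ha1 Sq h0 h1 h2 h3 hODE D hD h hx hns
  have e : D.pairing (.some x y h) (.some x y h) - ((x.num - 1 - 8 * A₄ : ℤ) : ℚ_[2])
      = (D.pairing (.some x y h) (.some x y h) - padicLog 2 (x.num : ℚ_[2]) + 8 * (V.a₄ : ℚ_[2]))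
        + ((padicLog 2 (x.num : ℚ_[2]) - 8 * (V.a₄ : ℚ_[2])) - ((x.num - 1 - 8 * A₄ : ℤ) : ℚ_[2])) := by ring
  rw [e]
  exact (Padic.nonarchimedean _ _).trans (max_le_max hB hlog)

/-- **THE LOG-FREE LEVEL-ONE LAW (kernel)**: if moreover `8 ∣ num x − 1` (at level one: `a₂` even), then
**`‖⟨Q,Q⟩_D − (num x − 1 − 8a₄)‖₂ ≤ 1/32`** — the σ-form height pairing of `Q` is congruent to the INTEGER `num x(Q) − 1 − 8a₄` modulo `32`.
[cite: MazurSteinTate2006, §1] [cite: Gouvea1993PadicNumbers, §5.7 Prop. 5.7.8] -/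
theorem norm_pairing_sub_int_le_of_dvd (V : WeierstrassCurve ℚ) [V.IsIntegral ℤ] (ha1 : V.a₁ = 0)
    (Sq : ℚ_[2]⟦X⟧) (h0 : constantCoeff Sq = 0) (h1 : coeff 1 Sq = 0) (h2 : coeff 2 Sq = 1) (h3 : coeff 3 Sq = 0)
    (hODE : (V.baseChange ℚ_[2]).SatisfiesSigmaSqODE Sq 0) (D : PAdicHeightData V 2)
    (hD : ∀ {x y : ℚ} (h : V.toAffine.Nonsingular x y), V.SatisfiesLocalConditions 2 (.some x y h) →
      D.pairing (.some x y h) (.some x y h) = padicLog 2 ((x.den : ℚ) : ℚ_[2]) - padicLog 2 (padicEval Sq (-(x : ℚ_[2]) / y)))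
    {x y : ℚ} (h : V.toAffine.Nonsingular x y) (hx : ‖(x : ℚ_[2])‖ = 4)
    (hns : ∀ ℓ : ℕ, ℓ.Prime → V.HasNonsingularReductionAt ℓ x y) {A₄ : ℤ} (hA4 : V.a₄ = A₄)
    (h8 : (8 : ℤ) ∣ x.num - 1) :
    ‖D.pairing (.some x y h) (.some x y h) - ((x.num - 1 - 8 * A₄ : ℤ) : ℚ_[2])‖ ≤ 32⁻¹ := by
  have ht8 : ‖(x.num : ℚ_[2]) - 1‖ ≤ 8⁻¹ := by
    have := (Padic.norm_int_le_pow_iff_dvd (p := 2) (x.num - 1) 3).mpr (by norm_num; exact h8)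
    push_cast at this
    exact this.trans (by norm_num)
  refine (norm_pairing_sub_int_le V ha1 Sq h0 h1 h2 h3 hODE D hD h hx hns hA4).trans (max_le le_rfl ?_)
  nlinarith [norm_nonneg ((x.num : ℚ_[2]) - 1)]

/-- **THE VALUATION LAW (kernel)**: if `32 ∤ num x − 1 − 8a₄` then **`‖⟨Q,Q⟩_D‖₂ = ‖num x − 1 − 8a₄‖₂`** (`v₂⟨Q,Q⟩_D = v₂(num x − 1 − 8a₄)
∈ {2, 3, 4}`) for a level-one `Q` with non-singular reduction everywhere (`a₁ = 0`, any σ-form datum `D`). [cite: MazurSteinTate2006, §1] -/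
theorem norm_pairing_eq_norm_of_not_dvd (V : WeierstrassCurve ℚ) [V.IsIntegral ℤ] (ha1 : V.a₁ = 0)
    (Sq : ℚ_[2]⟦X⟧) (h0 : constantCoeff Sq = 0) (h1 : coeff 1 Sq = 0) (h2 : coeff 2 Sq = 1) (h3 : coeff 3 Sq = 0)
    (hODE : (V.baseChange ℚ_[2]).SatisfiesSigmaSqODE Sq 0) (D : PAdicHeightData V 2)
    (hD : ∀ {x y : ℚ} (h : V.toAffine.Nonsingular x y), V.SatisfiesLocalConditions 2 (.some x y h) →
      D.pairing (.some x y h) (.some x y h) = padicLog 2 ((x.den : ℚ) : ℚ_[2]) - padicLog 2 (padicEval Sq (-(x : ℚ_[2]) / y)))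
    {x y : ℚ} (h : V.toAffine.Nonsingular x y) (hx : ‖(x : ℚ_[2])‖ = 4)
    (hns : ∀ ℓ : ℕ, ℓ.Prime → V.HasNonsingularReductionAt ℓ x y) {A₄ : ℤ} (hA4 : V.a₄ = A₄)
    (h32 : ¬ (32 : ℤ) ∣ x.num - 1 - 8 * A₄) :
    ‖D.pairing (.some x y h) (.some x y h)‖ = ‖((x.num - 1 - 8 * A₄ : ℤ) : ℚ_[2])‖ := by
  have hmax := norm_pairing_sub_int_le V ha1 Sq h0 h1 h2 h3 hODE D hD h hx hns hA4
  obtain ⟨-, ht4⟩ := norm_padicLog_num_sub_sub_int_le V h ha1 hx hA4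
  set n : ℚ_[2] := ((x.num - 1 - 8 * A₄ : ℤ) : ℚ_[2]) with hndef
  set t : ℚ_[2] := (x.num : ℚ_[2]) - 1 with htdef
  set Dv := D.pairing (.some x y h) (.some x y h)
  have hn32 : 32⁻¹ < ‖n‖ := by
    by_contra hle
    push Not at hle
    have h5 : ‖n‖ ≤ (2 : ℝ) ^ (-(5 : ℕ) : ℤ) := by norm_num; linarith
    exact h32 (by have := (Padic.norm_int_le_pow_iff_dvd (p := 2) (x.num - 1 - 8 * A₄) 5).mp h5; norm_num at this; exact this)
  have hn : n = t + -(8 * (A₄ : ℚ_[2])) := by rw [hndef, htdef]; push_cast; ring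
  have h8A : ‖-((8 : ℚ_[2]) * (A₄ : ℚ_[2]))‖ ≤ 8⁻¹ := by
    have h2 : ‖(2 : ℚ_[2])‖ = 2⁻¹ := by
      have := Padic.norm_p (p := 2); exact_mod_cast this
    have h8n : ‖(8 : ℚ_[2])‖ = 8⁻¹ := by
      rw [show (8 : ℚ_[2]) = 2 * 2 * 2 by norm_num, norm_mul, norm_mul, h2]; norm_num
    rw [norm_neg, norm_mul, h8n]
    calc (8⁻¹ : ℝ) * ‖(A₄ : ℚ_[2])‖ ≤ 8⁻¹ * 1 := by gcongr; exact Padic.norm_int_le_one _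
      _ = 8⁻¹ := by ring
  -- `‖Dv − n‖ < ‖n‖`
  have hlt : ‖Dv - n‖ < ‖n‖ := by
    refine lt_of_le_of_lt hmax (max_lt hn32 ?_)
    by_cases ht8 : ‖t‖ ≤ 8⁻¹
    · refine lt_of_le_of_lt ?_ hn32
      nlinarith [norm_nonneg t]
    · push Not at ht8
      have hnt : ‖n‖ = ‖t‖ := by
        rw [hn, Padic.add_eq_max_of_ne, max_eq_left (h8A.trans ht8.le)]
        exact (ne_of_lt (lt_of_le_of_lt h8A ht8)).symm
      rw [hnt]
      nlinarith [norm_nonneg t]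
  have e : Dv = (Dv - n) + n := by ring
  rw [e, Padic.add_eq_max_of_ne (ne_of_lt hlt), max_eq_right hlt.le]

end NaiveSigmaLogAtTwo

end Summit.BirchSwinnertonDyer.BirchSwinnertonDyer.Theorems
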